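import Mathlib
import Summits.ResolutionOfSingularities.ResolutionOfSingularities.Theorems.WeightedInvariantLocalWeightedDropNCResDoorOfBudget
import Summits.ResolutionOfSingularities.ResolutionOfSingularities.Theorems.WeightedInvariantLocalWeightedDropNCGameRankTupleDrop
import Summits.ResolutionOfSingularities.ResolutionOfSingularities.Theorems.WeightedInvariantLocalWeightedDropTOT2ConflictBudget

/-!
# `WeightedInvariant.LocalWeightedDrop` ENGINE: TAME HYPERSURFACE THREEFOLD GERMS WITH WIDE APEX ARE WON (T″|₄), and the NC door,
# now UNCONDITIONAL (the conflict budget (P3) has landed)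

Sub-problem `ResolutionOfSingularities`, ENGINE crux `stmt-ResolutionOfSingularities-8899` (`LocalWeightedDrop`), line hasse-ridge-face-selection,
skeleton v35 (2e806da509994632) → v36.  [OURS · L1 W4.3 · chain w43 · res-L1-w43-lead-1 g6 (registrar); def-free; 10-line compositions of tree
theorems; nothing here is a statement of any manuscript; AI-produced, gate-checked, weaker than expert review.]

With the registered stub `stub_conflictBudget` (P3) a tree theorem (res-L1-w43-stub-2's closer), the two derived skeleton nodes become tree theorems:
* `spaceNCRankDrop` — the DOOR `stub_spaceNCRankDrop` of v32 (= res-L1-w43-strat-1's `stub_doorSpaceNCRankDrop` of the directrix-cut line): positional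
  embedded normal-crossings resolution of surface germs in a regular threefold germ, ordinal form (`TameFourTupleDrop.spaceNCRankDrop_of_budgetEx`, p564082);
* `tameWideApexFourStartsWon` — the v29–v31 registered stub T″|₄ `stub_tameWideApexFourStartsWon` VERBATIM: tame (`p ∤ d`) hypersurface germs in FOUR
  variables with wide apex are won in the cobordant game, given the game below dimension 4 and below the order
  (`TameFourTupleDrop.tameWideApexFourStartsWon_of_ncRankDrop`, p526032).
-/

set_option linter.dupNamespace false -- mandated namespace of this single-conjunct summit

noncomputable section

namespace Summit.ResolutionOfSingularities.ResolutionOfSingularities.Theorems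

open Literature.AlgebraicGeometry.Resolution

/-- **THE NC DOOR, UNCONDITIONAL**: over an algebraically closed field of characteristic `p` there is ONE ordinal rank `ρ` on `k⟦x₀,x₁,x₂⟧` such
that from every non-zero germ whose support is not a normal crossing some move of the normal-crossing count game lowers `ρ` at every exceptional
point (v32 `stub_spaceNCRankDrop` text). -/
theorem spaceNCRankDrop : ∀ (p : ℕ), p.Prime → ∀ (k : Type) [Field k] [CharP k p] [IsAlgClosed k],
    ∃ ρ : MvPowerSeries (Fin 3) k → Ordinal.{0}, ∀ b : MvPowerSeries (Fin 3) k, b ≠ 0 → ¬ TameFourTupleDrop.GermIsNC b →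
      ∃ (Φ : Fin 3 → MvPowerSeries (Fin 3) k) (w : Fin 3 → ℕ),
        TameFourTupleDrop.IsCountMove (m := 2) Φ w ∧
          TameFourTupleDrop.MoveClause (m := 2) b Φ w (fun b' => ρ b' < ρ b) :=
  TameFourTupleDrop.spaceNCRankDrop_of_budgetEx stub_conflictBudget

/-- **T″|₄ — TAME HYPERSURFACE THREEFOLD GERMS WITH WIDE APEX ARE WON** (v29–v31 registered stub `stub_tameWideApexFourStartsWon`, statement
VERBATIM): for `p ∤ d = ord f`, quadratic part a square of a linear form, apex of the degree-`d` form at least a plane (for `d > 2`), the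
cobordant game from `f ∈ k⟦x₀,…,x₃⟧` is won — given the game for germs in fewer than four variables and for four-variable germs of smaller order. -/
theorem tameWideApexFourStartsWon : ∀ (p : ℕ), p.Prime → ∀ (k : Type) [Field k] [CharP k p] [IsAlgClosed k],
    (∀ m : ℕ, m < 4 → ∀ g : MvPowerSeries (Fin m) k,
      CobordantGame.IsSingular k g → CobordantGame.Won k m g) →
    ∀ (f : MvPowerSeries (Fin 4) k), CobordantGame.IsSingular k f →
    (∀ g : MvPowerSeries (Fin 4) k, CobordantGame.IsSingular k g → g.order < f.order →
      CobordantGame.Won k 4 g) →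
    ∀ (d : ℕ), f.order = d → ¬ p ∣ d →
    (∃ ℓ : Fin 4 → k, ∀ i j : Fin 4,
      MvPowerSeries.coeff (Finsupp.single i 1 + Finsupp.single j 1) f =
        MvPowerSeries.coeff (Finsupp.single i 1 + Finsupp.single j 1)
          ((∑ l, MvPowerSeries.C (ℓ l) * MvPowerSeries.X l) ^ 2)) →
    (2 < d → ∃ c₁ c₂ : Fin 4 → k, (∀ α β : k, α • c₁ + β • c₂ = 0 → α = 0 ∧ β = 0) ∧
      (∀ v : Fin 4 → k, CobordantChart.initEval (fun _ : Fin 4 => 1) (v + c₁) d f =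
        CobordantChart.initEval (fun _ : Fin 4 => 1) v d f) ∧
      (∀ v : Fin 4 → k, CobordantChart.initEval (fun _ : Fin 4 => 1) (v + c₂) d f =
        CobordantChart.initEval (fun _ : Fin 4 => 1) v d f)) →
    CobordantGame.Won k 4 f :=
  TameFourTupleDrop.tameWideApexFourStartsWon_of_ncRankDrop spaceNCRankDrop

end Summit.ResolutionOfSingularities.ResolutionOfSingularities.Theorems

end
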